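import Mathlib
import Summits.ValiantsHypothesis.ValiantsHypothesis.Theorems.LiouvilleSarnakAlignedTypeICharactersMod2nBilinearSievePostnikovLogTransport
import HarnessLib

/-!
# Route LiouvilleSarnak — support `AlignedTypeI` (stmt-ValiantsHypothesis-21040), line `characters_mod_2n`:
# Postnikov's formula from an abstract `2`-adic logarithm

Fourth brick for `HS`.  If `Λ : ℕ → ℤ` is a homomorphism of `1 + 2^τℕ` modulo `2^{n+τ}`
(`Λ(a + b + 2^τab) ≡ Λ(a) + Λ(b)`), depends on its argument only modulo `2^n`, and `Λ(1) = 2^τ ℓ` with `ℓ` odd, then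
for EVERY Dirichlet character `χ` mod `2^{n+τ}` (`τ ≥ 2`) there is an integer `c ≥ 0` with

  `χ(1 + 2^τ v) = e(c Λ(v) / 2^{n+τ})` for all `v ∈ ℕ`

(`postnikov_formula_of_log`).  Proof: `1 + 2^τ v ≡ g^d`, `g = 1 + 2^τ` (`…PostnikovCyclic`), `Λ(v) ≡ dΛ(1) = d 2^τ ℓ`
(`…PostnikovLogTransport`), `χ(g)` is a `2^n`-th root of unity `= ζ^k`, `ζ = e(1/2^n)`, and `c = k ℓ^{-1} (mod 2^n)`.

What remains for Postnikov's formula proper: the truncated `2`-adic logarithm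
`Λ(w) = Σ_{m ≤ n+τ} (−1)^{m−1} 2^{mτ − v₂(m)} (m 2^{−v₂(m)})^{-1} w^m (mod 2^{n+τ})` satisfies the three hypotheses
(the homomorphism property is the formal identity `log((1+x)(1+y)) = log(1+x) + log(1+y)` truncated; Mathlib has
`PowerSeries.log`, `PowerSeries.deriv_log`).

HONEST FRAMING. Helper theorem (unconditional, hypotheses by arrow on the abstract `Λ`); the leaf `AlignedTypeI` is NOT
closed here; nothing bears on `VP ≠ VNP` (NOT proved).
-/

set_option linter.dupNamespace false

noncomputable section

namespace Summit.ValiantsHypothesis.ValiantsHypothesis.Theorems.LiouvilleSarnak.AlignedTypeI.CharactersModTwoN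

open Finset Complex

/-- ★ **Postnikov's formula from an abstract logarithm**: `χ(1 + 2^τ v) = e(cΛ(v)/2^{n+τ})` for some `c ∈ ℕ`, for every
character `χ` mod `2^{n+τ}` (`τ ≥ 2`), whenever `Λ` is a homomorphism mod `2^{n+τ}` on `1 + 2^τℕ`, `2^n`-periodic, with
`Λ(1) = 2^τℓ`, `ℓ` odd. [folklore] -/
theorem postnikov_formula_of_log {τ : ℕ} (hτ : 2 ≤ τ) (n : ℕ) (Λ : ℕ → ℤ)
    (hhom : ∀ a b : ℕ, ((Λ (a + b + 2 ^ τ * a * b) : ℤ) : ZMod (2 ^ (n + τ))) =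
      (Λ a : ZMod (2 ^ (n + τ))) + (Λ b : ZMod (2 ^ (n + τ))))
    (hper : ∀ a b : ℕ, a % 2 ^ n = b % 2 ^ n → ((Λ a : ℤ) : ZMod (2 ^ (n + τ))) = (Λ b : ZMod (2 ^ (n + τ))))
    {ℓ : ℕ} (hℓ : Odd ℓ) (hone : Λ 1 = 2 ^ τ * ℓ) (χ : DirichletCharacter ℂ (2 ^ (n + τ))) :
    ∃ c : ℕ, ∀ v : ℕ,
      χ ((1 + 2 ^ τ * v : ℕ) : ZMod (2 ^ (n + τ))) =
        Complex.exp (2 * Real.pi * I * ((c : ℂ) * (Λ v : ℂ)) / (2 : ℂ) ^ (n + τ)) := by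
  haveI : NeZero (2 ^ n) := ⟨pow_ne_zero _ two_ne_zero⟩
  set g : ZMod (2 ^ (n + τ)) := ((1 + 2 ^ τ : ℕ) : ZMod (2 ^ (n + τ))) with hg
  -- `χ(g)` is a `2^n`-th root of unity
  set ζ : ℂ := Complex.exp (2 * Real.pi * I / ((2 ^ n : ℕ) : ℂ)) with hζ
  have hprim : IsPrimitiveRoot ζ (2 ^ n) := Complex.isPrimitiveRoot_exp (2 ^ n) (pow_ne_zero _ two_ne_zero)
  have hg1 : χ g ^ (2 ^ n) = 1 := (char_one_add_two_pow_mul_eq_pow hτ n χ 0).2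
  obtain ⟨k, hk, hζk⟩ := hprim.eq_pow_of_pow_eq_one hg1
  -- `ℓ` is invertible mod `2^n`; `c ℓ ≡ k`
  have hℓu : IsUnit ((ℓ : ℕ) : ZMod (2 ^ n)) := by
    rw [ZMod.isUnit_iff_coprime]
    exact Nat.Coprime.pow_right _ hℓ.coprime_two_right
  set c : ℕ := ((k : ZMod (2 ^ n)) * ((ℓ : ℕ) : ZMod (2 ^ n))⁻¹).val with hc
  have hcℓ : (((c * ℓ : ℕ) : ℤ) : ZMod (2 ^ n)) = ((k : ℤ) : ZMod (2 ^ n)) := by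
    push_cast
    rw [hc, ZMod.natCast_zmod_val, mul_assoc, ZMod.inv_mul_of_unit _ hℓu, mul_one]
  rw [ZMod.intCast_eq_intCast_iff_dvd_sub] at hcℓ
  obtain ⟨s, hs⟩ := hcℓ
  refine ⟨c, fun v => ?_⟩
  obtain ⟨d, -, hχ, hΛ⟩ := exists_pow_and_log_eq hτ n Λ hhom hper χ v
  rw [hχ]
  -- `Λ v ≡ d 2^τ ℓ (mod 2^{n+τ})`
  have hΛ' : ((Λ v : ℤ) : ZMod (2 ^ (n + τ))) = (((d : ℤ) * (2 ^ τ * ℓ) : ℤ) : ZMod (2 ^ (n + τ))) := by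
    rw [hΛ, hone]; push_cast; ring
  rw [ZMod.intCast_eq_intCast_iff_dvd_sub] at hΛ'
  obtain ⟨t, ht⟩ := hΛ'
  -- the complex computation
  change χ g ^ d = _
  rw [← hζk, ← pow_mul, hζ, ← Complex.exp_nat_mul]
  apply Complex.exp_eq_exp_iff_exists_int.2
  refine ⟨(s : ℤ) * d + (c : ℤ) * t, ?_⟩
  -- cast the two integer relations to `ℂ`
  have hsC : ((k : ℤ) : ℂ) - ((c * ℓ : ℕ) : ℤ) = ((2 ^ n : ℕ) : ℤ) * (s : ℂ) := by exact_mod_cast hs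
  have htC : ((d : ℤ) : ℂ) * ((2 : ℂ) ^ τ * (ℓ : ℂ)) - (Λ v : ℂ) = ((2 ^ (n + τ) : ℕ) : ℤ) * (t : ℂ) := by
    exact_mod_cast ht
  push_cast at hsC htC ⊢
  rw [pow_add] at htC
  have hk' : (k : ℂ) = (c : ℂ) * (ℓ : ℂ) + (2 : ℂ) ^ n * (s : ℂ) := by linear_combination hsC
  have hΛv' : ((Λ v : ℤ) : ℂ) = (d : ℂ) * ((2 : ℂ) ^ τ * (ℓ : ℂ)) - (2 : ℂ) ^ n * (2 : ℂ) ^ τ * (t : ℂ) := by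
    linear_combination -htC
  rw [hk', hΛv', pow_add]
  have h2n : (2 : ℂ) ^ n ≠ 0 := pow_ne_zero _ two_ne_zero
  have h2t : (2 : ℂ) ^ τ ≠ 0 := pow_ne_zero _ two_ne_zero
  field_simp
  ring

end Summit.ValiantsHypothesis.ValiantsHypothesis.Theorems.LiouvilleSarnak.AlignedTypeI.CharactersModTwoN
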